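import Literature.Computability.Complexity.AlmostP
import Literature.Computability.Complexity.PromiseBPPAmplificationExp
import Literature.Computability.Complexity.PromiseZPPProofs
import Literature.Computability.Complexity.TruthTableClosure
import Literature.Computability.Complexity.SigmaPRelClosure
import Literature.Computability.Complexity.FinitePatching
import Literature.Computability.QuantumComplexity.RandomOracleCylinders
import Mathlib.MeasureTheory.OuterMeasure.BorelCantelli
import Mathlib.Analysis.SpecificLimits.Basic
import HarnessLib

/-!
# Bennett–Gill's `BPP ⊆ ALMOST-P`: the proof (`BPP_subset_almostP_holds`)

Sibling proof file of `AlmostP.lean` (D-0014: the fact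
`Literature.Computability.Complexity.BPP_subset_almostP` stays a `def`; the other inclusion
`almostP_subset_BPP_holds` is `AlmostPProofs.lean`). We carry out the classical argument
(Bennett–Gill 1981; Book–Vollmer–Wagner 1996, §4 Thm. 3, first inclusion `B̂P²𝒦 ⊆ ALMOST-𝒦` for a
class "uniformly invariant under finite variations of the oracle", with consequence (1)
`ALMOST-P = BPP`, p. 375) over the tree's models — `BPP = bp P` with the counting probability
`uniformProb`, G01's transcript oracle machines `PRel`, the random oracle `randomOracleMeasure`:

1. (`exists_witness_exp_of_mem_BPP`) *Amplification.* For `L ∈ BPP` there are a witness `L'' ∈ P`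
   and a coin polynomial `p''` whose verdict `[⟨x, y⟩ ∈ L''] = [x ∈ L]` fails for at most an
   `exp(-(|x| + 1))` fraction of the coin strings `y ∈ {0,1}^{p''(|x|)}` (Arora–Barak 2009,
   Thm. 7.10, through the tree's `PromiseProblem.exists_amplifier_exp_of_mem_PromiseBPP'`).
2. (`BPPAlmostP.ttLang_id_mem_PRel`) *Coins from the oracle.* The oracle machine asks the fresh queries
   `⟨x, 1ⁱ⟩`, `i < p''(|x|)`, and feeds the answer bits to the decider of `L''`: this is the
   truth-table reduction `ttLang id p'' L'' A ∈ P^A` of `TruthTableClosure.lean`.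
3. (`BPPAlmostP.measure_setOf_err_le`) Under the random oracle the answer bits are independent
   fair coins (`randomOracleMeasure_restrictBool`), so the machine errs on `x` with probability
   `= uniformProb (p''(|x|)) (bad coins) ≤ exp(-(|x| + 1))`.
4. (`BPPAlmostP.tsum_measure_iUnion_err_ne_top`, Borel–Cantelli `MeasureTheory.ae_eventually_notMem`)
   `∑ₙ 2ⁿ e^{-(n+1)} < ∞`, so for almost every `A` the machine is correct on all inputs of length
   `≥ n₀(A)`.
5. (`mem_PRel_of_eqOn_le`) *Finite variations.* `P^A` is invariant under changing a language on
   the finitely many short inputs (`P^A` absorbs `∩`/`∪` with `P` languages,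
   `SigmaPRelClosure.lean`; finite and co-finite-by-length languages are in `P` by
   `mem_FP_of_eqOn_le`), hence `L ∈ P^A` for almost every `A`: `BPP_subset_almostP_holds`.

## References

* C. H. Bennett, J. Gill, *Relative to a random oracle `A`, `P^A ≠ NP^A ≠ co-NP^A` with
  probability 1*, SIAM J. Comput. 10 (1981) 96–113 [BennettGill1981] (not held: acq-00719; cited
  through Book–Vollmer–Wagner).
* R. V. Book, H. Vollmer, K. W. Wagner, *On type-2 probabilistic quantifiers*, ICALP 1996,
  LNCS 1099, 369–380 [BookVollmerWagner1996]: §3 (p. 373: `μ`, ALMOST-, `B̂P²`), §4 Thm. 3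
  (p. 374) and consequence (1) `ALMOST-P = BPP` (p. 375); read via
  `lit read book:editor1996-automata-languages-programming --pages 409-420`.
* S. Arora, B. Barak, *Computational Complexity: A Modern Approach*, CUP 2009, Thm. 7.10
  (error reduction), §3.4 (oracle machines) [AroraBarak2009].
* Mathlib: `MeasureTheory.ae_eventually_notMem` (first Borel–Cantelli lemma),
  `ENNReal.tsum_geometric`.
-/

noncomputable section

namespace Literature.Computability.Complexity

open _root_.MeasureTheory QuantumComplexity _root_.Computability OracleCompose Filter Finset
open scoped ENNReal

/-! ### Step 5: `P` and `P^O` are invariant under finite variations -/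

/-- **`P` is closed under finite variations**: if `L` agrees with some `L' ∈ P` on every input of
length `≥ n₀`, then `L ∈ P` (patch the deciding machine on the finitely many short inputs,
`mem_FP_of_eqOn_le`). [Arora–Barak 2009, §1.3; Book–Vollmer–Wagner 1996, §4 ("invariant under
finite variations")] [folklore] -/
theorem mem_P_of_eqOn_le {L L' : Language Bool} (hL' : L' ∈ Classes.P) (n₀ : ℕ)
    (h : ∀ x : List Bool, n₀ ≤ x.length → (x ∈ L ↔ x ∈ L')) : L ∈ Classes.P := by
  have hg : (fun x => encodeBool (L.boolIndicator x)) ∈ FP := by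
    refine mem_FP_of_eqOn_le (indicatorFn_mem_FP hL') n₀ fun z hz => ?_
    show encodeBool (L.boolIndicator z) = encodeBool (L'.boolIndicator z)
    by_cases hz' : z ∈ L
    · rw [(Set.mem_iff_boolIndicator _ _).1 hz', (Set.mem_iff_boolIndicator _ _).1 ((h z hz).1 hz')]
    · rw [(Set.notMem_iff_boolIndicator _ _).1 hz',
        (Set.notMem_iff_boolIndicator _ _).1 fun hz'' => hz' ((h z hz).2 hz'')]
  refine mem_P_of_mem_FP hg L fun w => ⟨fun hw => ?_, fun hw => ?_⟩
  · show encodeBool (L.boolIndicator w) = [true]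
    rw [(Set.mem_iff_boolIndicator _ _).1 hw]; rfl
  · show encodeBool (L.boolIndicator w) = [false]
    rw [(Set.notMem_iff_boolIndicator _ _).1 hw]; rfl

/-- The language of the inputs of length `≥ n₀` is in `P` (a patched constant). [folklore] -/
theorem setOf_le_length_mem_P (n₀ : ℕ) : ({x | n₀ ≤ x.length} : Language Bool) ∈ Classes.P :=
  mem_P_of_mem_FP (g := fun x => if n₀ ≤ x.length then [true] else [false])
    (mem_FP_of_eqOn_le (const_mem_FP [true]) n₀ fun _ hz => if_pos hz) _ fun _ =>
      ⟨fun hw => if_pos hw, fun hw => if_neg hw⟩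

/-- The short part `{x ∈ L | |x| < n₀}` of any language is in `P` (a finite language: patch the
constant `[0]`). [folklore] -/
theorem shortPart_mem_P (L : Language Bool) (n₀ : ℕ) :
    ({x | x ∈ L ∧ x.length < n₀} : Language Bool) ∈ Classes.P := by
  refine mem_P_of_mem_FP
    (g := fun x => if n₀ ≤ x.length then [false] else encodeBool (L.boolIndicator x))
    (mem_FP_of_eqOn_le (const_mem_FP [false]) n₀ fun z hz => if_pos hz) _ fun w =>
      ⟨fun hw => ?_, fun hw => ?_⟩
  · obtain ⟨hwL, hwn⟩ := hw
    show (if n₀ ≤ w.length then [false] else encodeBool (L.boolIndicator w)) = [true]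
    rw [if_neg (Nat.not_le.2 hwn), (Set.mem_iff_boolIndicator _ _).1 hwL]; rfl
  · show (if n₀ ≤ w.length then [false] else encodeBool (L.boolIndicator w)) = [false]
    by_cases hn : n₀ ≤ w.length
    · rw [if_pos hn]
    · have hwL : w ∉ L := fun hwL => hw ⟨hwL, Nat.not_le.1 hn⟩
      rw [if_neg hn, (Set.notMem_iff_boolIndicator _ _).1 hwL]; rfl

/-- **`P^O` is invariant under finite variations** (Book–Vollmer–Wagner 1996, hypothesis of
Thm. 3: `P` is "uniformly invariant under finite variations"): if `L` agrees with some `L' ∈ P^O`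
on every input of length `≥ n₀`, then `L ∈ P^O` — `L` is the union of its short part (in `P`)
with `{x | n₀ ≤ |x|} ∩ L'`, and `P^O` absorbs `∩`/`∪` with `P` languages.
[cite: BookVollmerWagner1996, §4 Thm. 3 (p. 374)] -/
theorem mem_PRel_of_eqOn_le {O : Oracle} {L L' : Language Bool} (hL' : L' ∈ PRel O) (n₀ : ℕ)
    (h : ∀ x : List Bool, n₀ ≤ x.length → (x ∈ L ↔ x ∈ L')) : L ∈ PRel O := by
  have hmem : ({x | x ∈ L ∧ x.length < n₀} : Language Bool) ⊔ ({x | n₀ ≤ x.length} ⊓ L') ∈ PRel O :=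
    union_P_mem_PRel (shortPart_mem_P L n₀) (inter_P_mem_PRel (setOf_le_length_mem_P n₀) hL')
  have hEq : L = ({x | x ∈ L ∧ x.length < n₀} : Language Bool) ⊔ ({x | n₀ ≤ x.length} ⊓ L') := by
    ext x
    change x ∈ L ↔ (x ∈ L ∧ x.length < n₀) ∨ (n₀ ≤ x.length ∧ x ∈ L')
    by_cases hn : n₀ ≤ x.length
    · rw [h x hn]
      constructor
      · exact fun hx => Or.inr ⟨hn, hx⟩
      · rintro (⟨-, hlt⟩ | ⟨-, hx⟩)
        · exact absurd hn (Nat.not_le.2 hlt)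
        · exact hx
    · constructor
      · exact fun hx => Or.inl ⟨hx, Nat.not_le.1 hn⟩
      · rintro (⟨hx, -⟩ | ⟨hle, -⟩)
        · exact hx
        · exact absurd hle hn
  rw [hEq]
  exact hmem

/-! ### Step 1: a witness with exponentially small error -/

/-- **Amplification.** For `L ∈ BPP` there are `L'' ∈ P` and a coin polynomial `p''` such that on
every input `x` the fraction of coin strings `y ∈ {0,1}^{p''(|x|)}` giving the wrong verdict
`¬ ([⟨x, y⟩ ∈ L''] ↔ [x ∈ L])` is at most `exp(-(|x| + 1))` (the tree's exponential error
reduction for promise-BPP, on the trivial promise). [cite: AroraBarak2009, Thm. 7.10] -/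
theorem exists_witness_exp_of_mem_BPP {L : Language Bool} (hL : L ∈ BPP) :
    ∃ L'' ∈ Classes.P, ∃ p'' : Polynomial ℕ, ∀ x : List Bool,
      uniformProb (p''.eval x.length) {y | ¬ (boolPair x y ∈ L'' ↔ x ∈ L)} ≤
        Real.exp (-((x.length : ℝ) + 1)) := by
  obtain ⟨L'', hL'', p'', hyes, hno, -⟩ :=
    PromiseProblem.exists_amplifier_exp_of_mem_PromiseBPP' (ofLanguage_mem_PromiseBPP'_iff.2 hL)
      Polynomial.X
  refine ⟨L'', hL'', p'', fun x => ?_⟩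
  have hr : (((Polynomial.X : Polynomial ℕ).eval x.length : ℕ) : ℝ) = (x.length : ℝ) := by
    rw [Polynomial.eval_X]
  by_cases hx : x ∈ L
  · have hset : {y : List Bool | ¬ (boolPair x y ∈ L'' ↔ x ∈ L)} = {y | boolPair x y ∉ L''} := by
      ext y; simp [hx]
    rw [hset, ← hr]
    exact hyes x hx
  · have hset : {y : List Bool | ¬ (boolPair x y ∈ L'' ↔ x ∈ L)} = {y | boolPair x y ∈ L''} := by
      ext y; simp [hx]
    rw [hset, ← hr]
    exact hno x hx

/-! ### Steps 2–3: coins read off the random oracle -/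

namespace BPPAlmostP

variable (L L'' : Language Bool) (p'' : Polynomial ℕ)

/-- Distinct indices give distinct queries `⟨x, 1ⁱ⟩`. [folklore] -/
theorem boolPair_replicate_injective (x : List Bool) :
    Function.Injective fun i : ℕ => boolPair x (List.replicate i true) := by
  intro i j h
  have h' := congrArg (fun w => (boolUnpair w).2.length) h
  simpa [boolUnpair_boolPair] using h'

/-- The indicator bit of a language is the `decide` bit of `restrictBool`. [folklore] -/
theorem boolIndicator_eq_restrictBool (A : Set (List Bool)) {U : Finset (List Bool)} (u : U) :
    A.boolIndicator u = restrictBool U A u := by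
  rw [Bool.eq_iff_iff, restrictBool_eq_true_iff]
  exact (Set.mem_iff_boolIndicator _ _).symm

/-- **The coin-reading machine is a `P^A` machine.** On input `x` it asks the fresh queries
`⟨x, 1ⁱ⟩`, `i < p''(|x|)`, and accepts iff `⟨x, b₀ ⋯ b_{p''(|x|)-1}⟩ ∈ L''` for the answer bits
`bᵢ = [⟨x, 1ⁱ⟩ ∈ A]`: the truth-table reduction `ttLang id p'' L'' A` (the machine `Mᴬ` of the
type-2 operators `BP²`, `B̂P²`, Book–Vollmer–Wagner 1996, §3). [cite: LadnerLynchSelman1975, §3] -/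
theorem ttLang_id_mem_PRel (hL'' : L'' ∈ Classes.P) (A : Set (List Bool)) :
    ttLang id p'' L'' A ∈ PRel (Oracle.ofLanguage A) :=
  ttLang_mem_PRel id_mem_FP hL'' A

/-- **The query window and its enumeration.** For an input `x` and `m` queries there are a set `U`
of `m` strings and an enumeration `e : Fin m ≃ U` (namely `e i = ⟨x, 1ⁱ⟩`) such that, for every
oracle `A`, the answer bits of the truth-table machine are the bits of `A` on `U` read through `e`.
[folklore] -/
theorem exists_window (x : List Bool) (m : ℕ) :
    ∃ (U : Finset (List Bool)) (e : Fin m ≃ U), U.card = m ∧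
      ∀ A : Set (List Bool), ttBits id A x m = List.ofFn fun i => restrictBool U A (e i) := by
  classical
  have hinj := boolPair_replicate_injective x
  obtain ⟨U, hmem, hcard⟩ : ∃ U : Finset (List Bool),
      (∀ u : List Bool, u ∈ U ↔ ∃ i : Fin m, boolPair x (List.replicate i true) = u) ∧ U.card = m :=
    ⟨(Finset.univ : Finset (Fin m)).map
      ⟨fun i : Fin m => boolPair x (List.replicate i true), fun _ _ h => Fin.ext (hinj h)⟩,
      fun u => by simp, by simp⟩
  obtain ⟨e, he⟩ : ∃ e : Fin m ≃ U, ∀ i : Fin m,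
      ((e i : U) : List Bool) = boolPair x (List.replicate i true) :=
    ⟨{ toFun := fun i => ⟨boolPair x (List.replicate i true), (hmem _).2 ⟨i, rfl⟩⟩
       invFun := fun u => ((hmem _).1 u.2).choose
       left_inv := fun i => Fin.ext (hinj ((hmem _).1 ((hmem _).2 ⟨i, rfl⟩)).choose_spec)
       right_inv := fun u => Subtype.ext ((hmem _).1 u.2).choose_spec }, fun _ => rfl⟩
  refine ⟨U, e, hcard, fun A => List.ext_getElem (by simp) fun i h₁ h₂ => ?_⟩
  rw [getElem_ttBits A x h₁, List.getElem_ofFn, ← boolIndicator_eq_restrictBool, he]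
  rfl

/-- **The error probability over the random oracle is the error probability over the coins**:
`μ {A | Mᴬ errs on x} = Pr_{y ∈ {0,1}^{p''(|x|)}}[¬ ([⟨x, y⟩ ∈ L''] ↔ [x ∈ L])]` — the bits of
the random oracle on the query window are independent fair coins
(`randomOracleMeasure_restrictBool`). [cite: BookVollmerWagner1996, §3 Prop. 1–2 (p. 373–374)] -/
theorem toReal_measure_setOf_err (x : List Bool) :
    (randomOracleMeasure {A : Set (List Bool) | ¬ (x ∈ ttLang id p'' L'' A ↔ x ∈ L)}).toReal =
      uniformProb (p''.eval x.length) {y | ¬ (boolPair x y ∈ L'' ↔ x ∈ L)} := by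
  classical
  obtain ⟨U, e, hcard, hbits⟩ := exists_window x (p''.eval x.length)
  have hevt : {A : Set (List Bool) | ¬ (x ∈ ttLang id p'' L'' A ↔ x ∈ L)} =
      {A | restrictBool U A ∈ Finset.univ.filter fun g : U → Bool =>
        ¬ (boolPair x (List.ofFn fun i => g (e i)) ∈ L'' ↔ x ∈ L)} := by
    ext A
    simp only [Set.mem_setOf_eq, Finset.mem_filter, Finset.mem_univ, true_and, mem_ttLang_iff, hbits]
  rw [hevt, randomOracleMeasure_restrictBool, hcard, uniformProb_eq_card_fun,
    ENNReal.toReal_mul, ENNReal.toReal_natCast, ENNReal.toReal_pow, ENNReal.toReal_inv,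
    ENNReal.toReal_ofNat, inv_pow, div_eq_mul_inv]
  congr 2
  refine Finset.card_equiv (e.symm.arrowCongr (Equiv.refl Bool)) fun g => ?_
  simp only [Finset.mem_filter, Finset.mem_univ, true_and]
  rfl

/-- **Step 3.** The coin-reading machine errs on `x` with probability at most `exp(-(|x| + 1))`.
[cite: BookVollmerWagner1996, §4 Thm. 3 (p. 374)] -/
theorem measure_setOf_err_le
    (herr : ∀ x : List Bool, uniformProb (p''.eval x.length) {y | ¬ (boolPair x y ∈ L'' ↔ x ∈ L)} ≤
      Real.exp (-((x.length : ℝ) + 1)))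
    (x : List Bool) :
    randomOracleMeasure {A : Set (List Bool) | ¬ (x ∈ ttLang id p'' L'' A ↔ x ∈ L)} ≤
      ENNReal.ofReal (Real.exp (-((x.length : ℝ) + 1))) := by
  rw [ENNReal.le_ofReal_iff_toReal_le (measure_ne_top _ _) (Real.exp_nonneg _),
    toReal_measure_setOf_err]
  exact herr x

/-! ### Step 4: Borel–Cantelli over the input lengths -/

/-- Union bound over the `2ⁿ` inputs of length `n`: the machine errs on some input of length `n`
with probability `≤ 2ⁿ e^{-(n+1)} = e⁻¹ (2/e)ⁿ`. [folklore] -/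
theorem measure_iUnion_err_le
    (herr : ∀ x : List Bool, uniformProb (p''.eval x.length) {y | ¬ (boolPair x y ∈ L'' ↔ x ∈ L)} ≤
      Real.exp (-((x.length : ℝ) + 1)))
    (n : ℕ) :
    randomOracleMeasure (⋃ v : List.Vector Bool n,
        {A : Set (List Bool) | ¬ (v.toList ∈ ttLang id p'' L'' A ↔ v.toList ∈ L)}) ≤
      ENNReal.ofReal (Real.exp (-1)) * ENNReal.ofReal (2 * Real.exp (-1)) ^ n := by
  calc randomOracleMeasure (⋃ v : List.Vector Bool n,
        {A : Set (List Bool) | ¬ (v.toList ∈ ttLang id p'' L'' A ↔ v.toList ∈ L)})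
      ≤ ∑ v : List.Vector Bool n,
          randomOracleMeasure {A : Set (List Bool) | ¬ (v.toList ∈ ttLang id p'' L'' A ↔ v.toList ∈ L)} :=
        measure_iUnion_fintype_le _ _
    _ ≤ ∑ _v : List.Vector Bool n, ENNReal.ofReal (Real.exp (-((n : ℝ) + 1))) :=
        Finset.sum_le_sum fun v _ => by
          simpa only [List.Vector.toList_length] using measure_setOf_err_le L L'' p'' herr v.toList
    _ = (2 : ℝ≥0∞) ^ n * ENNReal.ofReal (Real.exp (-((n : ℝ) + 1))) := by
        rw [Finset.sum_const, Finset.card_univ, card_vector, Fintype.card_bool, nsmul_eq_mul,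
          Nat.cast_pow, Nat.cast_ofNat]
    _ = ENNReal.ofReal (Real.exp (-1)) * ENNReal.ofReal (2 * Real.exp (-1)) ^ n := by
        rw [← ENNReal.ofReal_pow (by positivity), mul_pow, ← ENNReal.ofReal_mul (Real.exp_nonneg _),
          ← Real.exp_nat_mul, ← ENNReal.ofReal_ofNat, ← ENNReal.ofReal_pow (by positivity),
          ← ENNReal.ofReal_mul (by positivity)]
        congr 1
        rw [mul_left_comm, ← Real.exp_add]
        congr 2
        ring

/-- **The error probabilities are summable** over the input lengths:
`∑ₙ μ {A | Mᴬ errs on some input of length n} ≤ e⁻¹ ∑ₙ (2/e)ⁿ < ∞`.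
[cite: BookVollmerWagner1996, §4 Thm. 3 (p. 374)] -/
theorem tsum_measure_iUnion_err_ne_top
    (herr : ∀ x : List Bool, uniformProb (p''.eval x.length) {y | ¬ (boolPair x y ∈ L'' ↔ x ∈ L)} ≤
      Real.exp (-((x.length : ℝ) + 1))) :
    ∑' n, randomOracleMeasure (⋃ v : List.Vector Bool n,
        {A : Set (List Bool) | ¬ (v.toList ∈ ttLang id p'' L'' A ↔ v.toList ∈ L)}) ≠ ⊤ := by
  -- the ratio `2/e` is `< 1` (the same inequality is `two_mul_exp_neg_one_lt_one` of
  -- `Probability/Process/BrownianModulus.lean`, not imported into the complexity trunk)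
  have hratio : 2 * Real.exp (-1) < 1 := by
    have h2 : (2 : ℝ) < Real.exp 1 := by
      have := Real.add_one_lt_exp (one_ne_zero (α := ℝ))
      linarith
    rw [Real.exp_neg, ← div_eq_mul_inv, div_lt_one (Real.exp_pos 1)]
    exact h2
  refine ne_top_of_le_ne_top ?_ (ENNReal.tsum_le_tsum (measure_iUnion_err_le L L'' p'' herr))
  rw [ENNReal.tsum_mul_left, ENNReal.tsum_geometric]
  refine ENNReal.mul_ne_top ENNReal.ofReal_ne_top (ENNReal.inv_ne_top.2 ?_)
  exact (tsub_pos_iff_lt.2 (ENNReal.ofReal_lt_one.2 hratio)).ne'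

/-- **Step 4.** For almost every oracle `A` the coin-reading machine decides `L` on all inputs
of length `≥ n₀`, for some `n₀` depending on `A` (first Borel–Cantelli lemma,
`MeasureTheory.ae_eventually_notMem`). [cite: BookVollmerWagner1996, §4 Thm. 3 (p. 374)] -/
theorem ae_eventually_correct
    (herr : ∀ x : List Bool, uniformProb (p''.eval x.length) {y | ¬ (boolPair x y ∈ L'' ↔ x ∈ L)} ≤
      Real.exp (-((x.length : ℝ) + 1))) :
    ∀ᵐ (A : Set (List Bool)) ∂randomOracleMeasure,
      ∃ n₀ : ℕ, ∀ x : List Bool, n₀ ≤ x.length → (x ∈ L ↔ x ∈ ttLang id p'' L'' A) := by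
  filter_upwards [ae_eventually_notMem (tsum_measure_iUnion_err_ne_top L L'' p'' herr)] with A hA
  obtain ⟨n₀, hn₀⟩ := Filter.eventually_atTop.1 hA
  refine ⟨n₀, fun x hx => ?_⟩
  have h := hn₀ x.length hx
  simp only [Set.mem_iUnion, not_exists] at h
  have hx' : ¬ ¬ (x ∈ ttLang id p'' L'' A ↔ x ∈ L) := h ⟨x, rfl⟩
  exact (not_not.1 hx').symm

end BPPAlmostP

/-! ### The theorem -/

/-- **Bennett–Gill's theorem `BPP ⊆ ALMOST-P`** (discharge of the named fact
`BPP_subset_almostP` of `AlmostP.lean`): every `BPP` language is in `P^A` for almost every oracle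
`A` — amplify the error below `e^{-(|x|+1)}`, read the coins off the fresh oracle positions
`⟨x, 1ⁱ⟩`, Borel–Cantelli over the input lengths, and patch the finitely many short inputs.
[cite: BookVollmerWagner1996, §1 (p. 370, "ALMOST-P = BPP [5, 19]") and §4 Thm. 3 with (1) (p. 374–375)] -/
theorem BPP_subset_almostP_holds : BPP_subset_almostP := by
  intro L hL
  obtain ⟨L'', hL'', p'', herr⟩ := exists_witness_exp_of_mem_BPP hL
  rw [mem_almostP_iff]
  filter_upwards [BPPAlmostP.ae_eventually_correct L L'' p'' herr] with A ⟨n₀, hn₀⟩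
  exact mem_PRel_of_eqOn_le (BPPAlmostP.ttLang_id_mem_PRel L'' p'' hL'' A) n₀ hn₀

end Literature.Computability.Complexity

end
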